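import Mathlib
import Literature.MathematicalPhysics.QuantumLattice.HubbardBandSectorCountingToolbox
import Summits.HubbardSuperconductivity.HubbardSuperconductivity.Theorems.KLProgrammeKLRegimeTwoPointLimitShellTransversality
import Summits.HubbardSuperconductivity.HubbardSuperconductivity.Theorems.KLProgrammeKLRegimeTwoPointLimitShellMeasure1D
import Summits.HubbardSuperconductivity.HubbardSuperconductivity.Theorems.KLProgrammeKLRegimeTwoPointLimitShellCountCooper
import Summits.HubbardSuperconductivity.HubbardSuperconductivity.Theorems.KLProgrammeKLRegimeTwoPointLimitShellCountCaustic
import HarnessLib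

/-!
# Route `KLProgramme` — crux K3 `KLRegimeTwoPointLimit` (stmt-HubbardSuperconductivity-19937), support:
# the angular measure bound of Lemmas E.1 / E.3 in the transversal regimes (DECOMP App. E)

Cell `gate-hubbard-kl`, seat p1b; paper note `HOME/prover-p1b/E1-NOTE.md` §3 (assembly, regimes (i) and
(ii)). After the tube reduction, the two-shell phase-space bound is a bound on the Lebesgue measure of
the angular sublevel set `Θ_w(δ) = {θ ∈ period : |ε(p_μ(θ) - w) - μ| ≤ δ}` of the translated band
Fermi curve. This file assembles the seat's chain (pointwise slope bound `klst_slope_lower_bound`,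
shell-measure lemma `klsm_volume_sublevel_le`, intersection counts `klcc_zeros_card_le_three`,
`klsd_zeros_card_le_awayFromCooper`) into the two transversal-regime bounds:

* `klsa_volume_sublevel_le_cooper` — **Cooper regime** (small transfer, `|w| ≤ ρ_min s`): if the slope
  data hold with level defect `η ≥ δ` and slope `λ` (in the final constants `λ ≍ |w|_𝕋`), then
  `|Θ_w(δ)| ≤ 5·(δ/λ)` — the SHARP linear law `≍ δ/|w|` of Lemma E.1 (three zeros, not `O(1/|w|)`),
  which is what makes the particle–particle increments summable below the transfer scale (freezing,
  E2(a) / Lemma E.4);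
* `klsa_volume_sublevel_le_transversal` — **uniformly transversal regime** (torus distance `≥ v` from
  the Cooper point and slope data with constants): `|Θ_w(δ)| ≤ (2π/ℓ + 27)·(δ/λ)`, i.e. `O(δ)`.

What is deliberately NOT here: the caustic regime (windows where the slope degenerates; the
square-root cap `klsc_volume_sublevel_le_of_convex_sqrt` applies there) and the tube reduction /
area form.
-/

noncomputable section

-- the tree's namespace `Summit.<Summit>.<Problem>.Theorems` repeats the summit name by design (D-0017)
set_option linter.dupNamespace false

open Real Set MeasureTheory
open scoped ENNReal
open Literature.MathematicalPhysics.QuantumLattice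
open Literature.MathematicalPhysics.QuantumLattice.BandSectorCounting

namespace Summit.HubbardSuperconductivity.HubbardSuperconductivity.Theorems

section Main

variable {a b : ℝ} (B : BandBounds a b) {μ : ℝ} (hμ : μ ∈ Icc a b)
include B hμ

/-- The slope bound on a sublevel set, in the form the shell-measure lemma consumes: under the
hypotheses of `klst_slope_lower_bound` with level defect `η`, every point of
`{θ ∈ I : |G_w(θ)| ≤ δ}`, `δ ≤ η`, has `|G_w'(θ)| ≥ 2λ`. -/
theorem klsa_slope_on_sublevel {η δ lam r₀ r₂ w₁ w₂ : ℝ} (I : Set ℝ)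
    (hlo : a ≤ μ - η) (hhi : μ + η ≤ b) (hδ : δ ≤ η)
    (hr₀ : ∀ m₀ m₁ : ℤ, r₀ ≤ max |w₁ - m₀ * (2 * π)| |w₂ - m₁ * (2 * π)|)
    (hr₂ : ∀ (m₀ m₁ : ℤ) (φ : ℝ),
      r₂ ≤ max |w₁ - m₀ * (2 * π) - 2 * bandX μ φ| |w₂ - m₁ * (2 * π) - 2 * bandY μ φ|)
    (h₀ : B.smax * (B.Cg * (lam + 2 * B.smax * (η / B.Dtmin))) + η / B.Dtmin < r₀)
    (h₂ : B.A2 / 4 * (B.Cg * (lam + 2 * B.smax * (η / B.Dtmin))) ^ 2 + η / B.Dtmin < r₂) :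
    ∀ t ∈ I, |eps2 (bandX μ t - w₁) (bandY μ t - w₂) - μ| ≤ δ →
      2 * lam ≤ |2 * (Real.sin (bandX μ t - w₁) * bandVX μ t + Real.sin (bandY μ t - w₂) * bandVY μ t)| := by
  intro t _ ht
  have hlt := klst_slope_lower_bound B hμ hlo hhi (ht.trans hδ) hr₀ hr₂ h₀ h₂
  rw [abs_mul, abs_two]
  linarith

/-- **Angular bound, Cooper regime.** For a small nonzero transfer `w` (`|w| ≤ ρ_min s`, `s < 1`)
with slope data `(η, λ, r₀, r₂)` as in `klst_slope_lower_bound` and `√2·π·|w|·s + |w|² ≤ η`, every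
sublevel set `{θ ∈ [θ₀, θ₀ + 2π] : |ε(p_μ(θ) - w) - μ| ≤ δ}` with `δ ≤ η` has measure `≤ 5·(δ/λ)`.
(Three zeros per period by `klcc_zeros_card_le_three`, slope `≥ 2λ` on the sublevel set, and the
shell-measure lemma.) With `λ ≍ |w|_𝕋` this is the linear law `C δ/|w|_𝕋` of Lemma E.1. -/
theorem klsa_volume_sublevel_le_cooper {η δ lam r₀ r₂ w₁ w₂ s θ₀ : ℝ}
    (hlo : a ≤ μ - η) (hhi : μ + η ≤ b) (hδ : δ ≤ η)
    (hs0 : 0 ≤ s) (hs1 : s < 1)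
    (hw : 0 < Real.sqrt (w₁ ^ 2 + w₂ ^ 2)) (hws : Real.sqrt (w₁ ^ 2 + w₂ ^ 2) ≤ B.rhomin * s)
    (hη : Real.sqrt 2 * π * Real.sqrt (w₁ ^ 2 + w₂ ^ 2) * s + (w₁ ^ 2 + w₂ ^ 2) ≤ η)
    (hlam : 0 < lam)
    (hr₀ : ∀ m₀ m₁ : ℤ, r₀ ≤ max |w₁ - m₀ * (2 * π)| |w₂ - m₁ * (2 * π)|)
    (hr₂ : ∀ (m₀ m₁ : ℤ) (φ : ℝ),
      r₂ ≤ max |w₁ - m₀ * (2 * π) - 2 * bandX μ φ| |w₂ - m₁ * (2 * π) - 2 * bandY μ φ|)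
    (h₀ : B.smax * (B.Cg * (lam + 2 * B.smax * (η / B.Dtmin))) + η / B.Dtmin < r₀)
    (h₂ : B.A2 / 4 * (B.Cg * (lam + 2 * B.smax * (η / B.Dtmin))) ^ 2 + η / B.Dtmin < r₂) :
    volume {θ ∈ Icc θ₀ (θ₀ + 2 * π) | |eps2 (bandX μ θ - w₁) (bandY μ θ - w₂) - μ| ≤ δ} ≤
      5 * ENNReal.ofReal (δ / lam) := by
  obtain ⟨h1, h2⟩ := B.level hμ
  have hGd : ∀ t, HasDerivAt (fun t => eps2 (bandX μ t - w₁) (bandY μ t - w₂) - μ)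
      (2 * (Real.sin (bandX μ t - w₁) * bandVX μ t + Real.sin (bandY μ t - w₂) * bandVY μ t)) t :=
    fun t => (klst_hasDerivAt_transLevel h1 h2 w₁ w₂ t).sub_const μ
  have htrans := klsa_slope_on_sublevel B hμ (Icc θ₀ (θ₀ + 2 * π)) hlo hhi hδ hr₀ hr₂ h₀ h₂
  obtain ⟨Z, hZcard, hZmem⟩ :=
    klcc_zeros_card_le_three B hμ hlo hhi hs0 hs1 hw hws hη hlam hr₀ hr₂ h₀ h₂ (θ₀ := θ₀)
  have hZ : ∀ c ∈ Icc θ₀ (θ₀ + 2 * π), eps2 (bandX μ c - w₁) (bandY μ c - w₂) - μ = 0 → c ∈ Z :=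
    fun c hc h0 => hZmem c hc (by linarith)
  have hvol := klsm_volume_sublevel_le hGd (by linarith : 0 < 2 * lam) htrans Z hZ
  refine hvol.trans ?_
  have hcard : ((Z.card : ℝ≥0∞) + 2) ≤ 5 := by
    have : (Z.card : ℝ≥0∞) ≤ 3 := by exact_mod_cast hZcard
    calc (Z.card : ℝ≥0∞) + 2 ≤ 3 + 2 := by gcongr
      _ = 5 := by norm_num
  have hδl : 2 * δ / (2 * lam) = δ / lam := by field_simp
  rw [hδl]
  gcongr

/-- **Angular bound, uniformly transversal regime.** If `w` keeps torus sup-distance `≥ v` from the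
Cooper point `2πℤ²`, the count hypotheses of `klsd_zeros_card_le_awayFromCooper` hold (parameters
`η₁, ℓ, ρ₂`), and the slope data `(η, λ, v, r₂)` of `klst_slope_lower_bound` hold, then every
sublevel set `{θ ∈ [θ₀, θ₀ + 2π] : |ε(p_μ(θ) - w) - μ| ≤ δ}` with `δ ≤ η` has measure
`≤ (2π/ℓ + 27)·(δ/λ)`: `O(δ)` with constants, the generic case of Lemmas E.1/E.3. -/
theorem klsa_volume_sublevel_le_transversal {η η₁ δ lam v r₂ ℓ ρ₂ w₁ w₂ θ₀ : ℝ}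
    (hlo : a ≤ μ - η) (hhi : μ + η ≤ b) (hδ : δ ≤ η) (hlam : 0 < lam)
    (hr₀ : ∀ m₀ m₁ : ℤ, v ≤ max |w₁ - m₀ * (2 * π)| |w₂ - m₁ * (2 * π)|)
    (hr₂ : ∀ (m₀ m₁ : ℤ) (φ : ℝ),
      r₂ ≤ max |w₁ - m₀ * (2 * π) - 2 * bandX μ φ| |w₂ - m₁ * (2 * π) - 2 * bandY μ φ|)
    (h₀ : B.smax * (B.Cg * (lam + 2 * B.smax * (η / B.Dtmin))) + η / B.Dtmin < v)
    (h₂ : B.A2 / 4 * (B.Cg * (lam + 2 * B.smax * (η / B.Dtmin))) ^ 2 + η / B.Dtmin < r₂)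
    -- count data
    (hlo₁ : a ≤ μ - η₁) (hhi₁ : μ + η₁ ≤ b) (hℓ : 0 < ℓ) (hηℓ : 4 * B.smax * ℓ ≤ η₁)
    (hH1 : B.smax * (B.Cg * (2 * B.smax * (η₁ / B.Dtmin))) + η₁ / B.Dtmin < v)
    (hρ₂ : B.smax * (B.Cg * (2 * B.smax * (η₁ / B.Dtmin))) +
        B.A2 / 4 * (B.Cg * (2 * B.smax * (η₁ / B.Dtmin))) ^ 2 + η₁ / B.Dtmin + 2 * B.smax * ℓ ≤ ρ₂)
    (hσ : ρ₂ / (Real.sqrt 2 * B.umin) < 2)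
    (hconv : (4 * B.smax ^ 2 + 4 * B.A2) * (2 * B.smax * (π * (ρ₂ / (Real.sqrt 2 * B.umin))) + ρ₂) <
      4 * B.hmin)
    (hH4 : 2 * umklappRadius μ + ρ₂ < 2 * π) :
    volume {θ ∈ Icc θ₀ (θ₀ + 2 * π) | |eps2 (bandX μ θ - w₁) (bandY μ θ - w₂) - μ| ≤ δ} ≤
      ENNReal.ofReal (2 * π / ℓ + 27) * ENNReal.ofReal (δ / lam) := by
  obtain ⟨h1, h2⟩ := B.level hμ
  have hπ := Real.pi_pos
  have hGd : ∀ t, HasDerivAt (fun t => eps2 (bandX μ t - w₁) (bandY μ t - w₂) - μ)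
      (2 * (Real.sin (bandX μ t - w₁) * bandVX μ t + Real.sin (bandY μ t - w₂) * bandVY μ t)) t :=
    fun t => (klst_hasDerivAt_transLevel h1 h2 w₁ w₂ t).sub_const μ
  have htrans := klsa_slope_on_sublevel B hμ (Icc θ₀ (θ₀ + 2 * π)) hlo hhi hδ hr₀ hr₂ h₀ h₂
  obtain ⟨Z, hZcard, hZmem⟩ := klsd_zeros_card_le_awayFromCooper B hμ hlo₁ hhi₁ hℓ hηℓ hr₀ hH1 hρ₂
    hσ hconv hH4 (θ₀ := θ₀)
  have hZ : ∀ c ∈ Icc θ₀ (θ₀ + 2 * π), eps2 (bandX μ c - w₁) (bandY μ c - w₂) - μ = 0 → c ∈ Z :=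
    fun c hc h0 => hZmem c hc (by linarith)
  have hvol := klsm_volume_sublevel_le hGd (by linarith : 0 < 2 * lam) htrans Z hZ
  refine hvol.trans ?_
  have hδl : 2 * δ / (2 * lam) = δ / lam := by field_simp
  rw [hδl]
  gcongr
  have hc : (Z.card : ℝ) + 2 ≤ 2 * π / ℓ + 27 := by linarith
  have h0 : (0 : ℝ) ≤ 2 * π / ℓ + 27 := by positivity
  calc (Z.card : ℝ≥0∞) + 2 = ENNReal.ofReal ((Z.card : ℝ) + 2) := by
        rw [ENNReal.ofReal_add (by positivity) (by norm_num)]; simp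
    _ ≤ ENNReal.ofReal (2 * π / ℓ + 27) := ENNReal.ofReal_le_ofReal hc

end Main

end Summit.HubbardSuperconductivity.HubbardSuperconductivity.Theorems

end
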